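import Summits.HodgeConjecture.CorCM.LefschetzAlgebraQuaternionCentre
import Summits.HodgeConjecture.CorCM.LefschetzAlgebraTotallyRealField
import Summits.HodgeConjecture.CorCM.MumfordTateRankSevenQuaternionConverse
import HarnessLib

/-!
# Types II(e) and III(e): the exact Lefschetz dimension `e · m(2m ± 1)`, the skipped rank, and Hodge = Lefschetz

Sub-problem `CorCM` of `HodgeConjecture` (cell `pub-hodgecm2`, count-neutral Mumford–Tate-rank lane of seat `b27`; theorems only,
no new definition, no named fact; nothing here uses or asserts `HC_CM`).  Let `B` be a simple complex abelian variety whose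
endomorphism algebra `End⁰B` is a quaternion algebra over a totally real number field `K` of degree `e`, `dim B = 2em`, and let
`ψ` be a polarization of `H¹(B, ℚ)`; write `Lef(ψ) = C(End_Hdg(H¹B)) ∩ 𝔰𝔭(ψ)` for the Lefschetz Lie algebra and
`t(B) = dim MT(H¹B) = dim Lie Hg(H¹B) + 1`.

1. `finrank_lefschetz_eq_of_isTotallyDefinite_centre` — type III(e): **`dim Lef(ψ) = e · m(2m − 1)`**;
   `finrank_lefschetz_eq_of_isTotallyIndefinite_centre` — type II(e): **`dim Lef(ψ) = e · m(2m + 1)`** (Milne's `g²/2f ∓ g/2`,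
   `f = e`, `g = 2em`, now as equalities for the Lie algebra).
2. `mtRank_hodge_one_ne_lefschetz_of_isTotallyDefinite_centre`, `…_of_isTotallyIndefinite_centre` — **the rank `t = e · m(2m ∓ 1)`
   is skipped**: `Lie Hg ⊆ Lef(ψ)` is never of codimension one (`CorCM/HodgeLieLefschetzCodimension`, no type IV), so either
   `t = e · m(2m ∓ 1) + 1` (Hodge = Lefschetz) or `t ≤ e · m(2m ∓ 1) − 1`.
3. `hodgeLie_hodge_one_eq_lefschetz_iff_of_isTotallyDefinite_centre`, `…_of_isTotallyIndefinite_centre` — **Hodge = Lefschetz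
   (`Lie Hg(H¹B) = Lef(ψ)`) iff `dim Lie Hg(H¹B) = e · m(2m ∓ 1)`**, i.e. iff `t(B)` attains the Lefschetz bound of
   `CorCM/MumfordTateRankQuaternionLefschetzBound`.
4. `mtRank_hodge_one_eq_seven_of_isSimple_fourfold_of_finrank_centre_eq_two`,
   `hodgeLie_hodge_one_eq_lefschetz_of_isSimple_fourfold_of_finrank_centre_eq_two` — **the `(2,2,2)` fourfolds: a simple
   abelian fourfold with quaternion multiplication over a real quadratic field has `t = 7` and `Lie Hg(H¹B) = Lef(ψ)`**
   (Moonen–Zarhin Thm. (0.1) case `D_B` of type II(2); type III(2) is impossible by Shimura): `t ≤ 7` (bound), `t ≠ 6`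
   (skipped), `t ≠ 5` (no type IV), `t ≠ 4` (`dim End⁰B = 8 ≠ 16`), `t ≥ 4` (not CM).  With
   `CorCM/MumfordTateRankTypeTwoFourfoldLefschetz` (centre `ℚ`): Hodge = Lefschetz for every simple abelian fourfold whose
   endomorphism algebra is a quaternion algebra over `ℚ` or over a real quadratic field.

METHOD.  The engine `exists_finrank_lefschetz_eq_of_centre_basis` (`CorCM/LefschetzAlgebraQuaternionCentre`: `Lef(ψ)` is the
restriction of scalars of `C_K(i, j) ∩ 𝔰𝔭(ψ_K)`, `ψ = Tr_{K/ℚ} ∘ ψ_K`) applied to a quaternionic basis adapted to the Rosati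
involution: for type III the Rosati involution is the canonical involution (Lange Thm. 2.6.5 (c)) and any basis `i, j` of
`End⁰B ≅ (a, b / K)` is Rosati-skew; for type II it is `x ↦ w₀⁻¹ x̄ w₀` with `w₀² = α` totally negative (Thm. 2.6.5 (b)) and a basis
through `i = w₀` has `i` skew, `j` symmetric.

## References
* [Milne1999LefschetzClasses] J. S. Milne, *Lefschetz classes on abelian varieties*, Duke Math. J. 96 (1999), §2 and Summary.
* [Lange2023AbelianVarietiesComplex] H. Lange, *Abelian Varieties over the Complex Numbers*, Springer 2023, §2.6.2 Thm. 2.6.5.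
* [MoonenZarhin1999LowDim] B. Moonen, Yu. G. Zarhin, *Hodge classes on abelian varieties of low dimension*, Math. Ann. 315 (1999), §1.
* [Murty1984ExceptionalHodgeClasses] V. K. Murty, *Exceptional Hodge classes on certain abelian varieties*, Math. Ann. 268 (1984), §2–3.
-/

noncomputable section

namespace Summit.HodgeConjecture.CorCM

open scoped TensorProduct Quaternion
open CategoryTheory CategoryTheory.Limits Module NumberField
open Literature.AlgebraicGeometry.Motives
open Literature.AlgebraicGeometry.Motives.AbelianVariety
open Literature.AlgebraicGeometry.Motives.HodgeStructure
open Literature.AlgebraicGeometry.HodgeTheory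
open Literature.AlgebraicGeometry.ComplexMultiplication (bettiRep bettiRep_injective)
open Literature.NumberTheory.Automorphic (IsQuaternionAlgebra IsTotallyDefinite standardInvolution standardInvolution_algEquiv
  standardInvolution_quaternionAlgebra)
open Literature.RingTheory.CentralSimple
open Literature.Algebra.Lie
open Literature.AlgebraicGeometry.Milne1999 (IsOfCMType)
open Literature.LinearAlgebra.QuadraticForm

variable [HodgeTensorFacts.{0, 0}]

/-! ## §1 Type III(e): `dim Lef(ψ) = e · m(2m − 1)` -/

/-- **The Lefschetz Lie algebra of type III(e):** for `B` simple with `End⁰B` a totally definite quaternion algebra over a totally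
real `K` of degree `e` and `dim B = 2em`, **`dim (C(End_Hdg(H¹B)) ∩ 𝔰𝔭(ψ)) = e · m(2m − 1)`** for every polarization `ψ`
(Milne: `S(B)_ℝ ≅ ∏_{K ↪ ℝ} O_{2m}`... at the Lie level `Res_{K/ℚ} 𝔬_{2m}`-form, `dim = g²/2f − g/2`).
[cite: Milne1999LefschetzClasses, §2 (type III) and Summary] [cite: Lange2023AbelianVarietiesComplex, §2.6.2 Thm. 2.6.5 (c)] -/
theorem finrank_lefschetz_eq_of_isTotallyDefinite_centre {B : AbelianVariety ℂ} {k : ℕ} (hB : IsSmoothProjective k B.X)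
    (hBs : B.IsSimple) {K : Type} [Field K] [NumberField K] [IsTotallyReal K] [Algebra K B.endAlgebra]
    [IsScalarTower ℚ K B.endAlgebra] [IsQuaternionAlgebra K B.endAlgebra] (hdef : IsTotallyDefinite K B.endAlgebra) {m : ℕ}
    (hBm : B.dim = 2 * m * Module.finrank ℚ K) [Module.Finite ℚ (bettiCohomology B.X 1)]
    (ψ : (BettiUniverse.hodge exists_isReal_hodgeModel_holds hB 1).Polarization) :
    Module.finrank ℚ ↥(Subalgebra.toSubmodule (Subalgebra.centralizer ℚ
        ((BettiUniverse.hodge exists_isReal_hodgeModel_holds hB 1).endAlg : Set (Module.End ℚ (bettiCohomology B.X 1)))) ⊓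
      ψ.form.skewAdjointSubmodule) = Module.finrank ℚ K * (m * (2 * m - 1)) := by
  classical
  have hk : B.dim = k := schemeDim_eq_holds hB
  subst hk
  -- the Rosati involution is the canonical involution of the definite quaternion algebra `End⁰B` over `K`
  have hD : ∀ x : B.endAlgebra, x ≠ 0 → IsUnit x := fun x hx => (isUnit_or_eq_zero_of_isSimple hBs x).resolve_right hx
  have hA4 : HasNoTypeIVFactor B := AbelianVariety.hasNoTypeIVFactor_of_isTotallyReal (K := K)
  have hpos := AbelianVariety.isPositiveAntiInvolution_rosati (A := B) exists_isReal_hodgeModel_holds hodgePQ_independent_of_hodgeModel_holds ψ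
  have h1 := AbelianVariety.isOfFirstKind_rosati (A := B) exists_isReal_hodgeModel_holds hodgePQ_independent_of_hodgeModel_holds ψ hA4 (K := K)
  have hros : ∀ x, AbelianVariety.rosati B exists_isReal_hodgeModel_holds hodgePQ_independent_of_hodgeModel_holds ψ x = standardInvolution K B.endAlgebra x := by
    obtain ⟨-, h⟩ := (isPositiveAntiInvolution_iff_of_isOfFirstKind K hD h1).mp hpos
    rcases h with ⟨-, h⟩ | ⟨hind, -⟩
    · exact h
    · obtain ⟨w⟩ : Nonempty (InfinitePlace K) := inferInstance
      exact absurd (hind.isSplitAtInfinite w) (hdef w)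
  obtain ⟨a, b, ha, hb, -, ⟨e⟩⟩ := exists_algEquiv_quaternionAlgebra_totallyNeg_of_isTotallyDefinite K B.endAlgebra hdef
  set q := (QuaternionAlgebra.Basis.self K).compHom (e.symm : ℍ[K,a,b] →ₐ[K] B.endAlgebra) with hq
  have hqi : q.i = e.symm ⟨0, 1, 0, 0⟩ := rfl
  have hqj : q.j = e.symm ⟨0, 0, 1, 0⟩ := rfl
  have hstar_i : standardInvolution K B.endAlgebra q.i = -q.i := by
    rw [hqi, standardInvolution_algEquiv, standardInvolution_quaternionAlgebra, ← map_neg]; congr 1; ext <;> simp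
  have hstar_j : standardInvolution K B.endAlgebra q.j = -q.j := by
    rw [hqj, standardInvolution_algEquiv, standardInvolution_quaternionAlgebra, ← map_neg]; congr 1; ext <;> simp
  have hru : AbelianVariety.rosati B exists_isReal_hodgeModel_holds hodgePQ_independent_of_hodgeModel_holds ψ q.i = -q.i := by rw [hros, hstar_i]
  have hrv : AbelianVariety.rosati B exists_isReal_hodgeModel_holds hodgePQ_independent_of_hodgeModel_holds ψ q.j = -q.j := by rw [hros, hstar_j]
  have hqb : Function.Bijective q.liftHom := by
    have hql : q.liftHom = (e.symm : ℍ[K,a,b] →ₐ[K] B.endAlgebra) := QuaternionAlgebra.lift.apply_symm_apply _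
    rw [hql]; exact e.symm.bijective
  obtain ⟨n, M, hn, hdim, h3, -⟩ := exists_finrank_lefschetz_eq_of_centre_basis (B := B) ψ ha hb q hqb hru
  have hcount := h3 hrv
  have hdimV : Module.finrank ℚ (bettiCohomology B.X 1) = 4 * m * Module.finrank ℚ K := by
    rw [finrank_bettiCohomology_one_eq_two_mul_dim B, hBm]; ring
  have he : 0 < Module.finrank ℚ K := Module.finrank_pos
  have hn4 : n = 4 * m := by
    have h' : Module.finrank ℚ K * n = Module.finrank ℚ K * (4 * m) := by rw [hn, hdimV]; ring
    exact Nat.eq_of_mul_eq_mul_left he h'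
  subst hn4
  set p := m * m with hp
  have h16 : 4 * m * (4 * m) = 16 * p := by rw [hp]; ring
  rw [h16] at hcount
  have hM : M = 2 * p - m := by omega
  have hgoal : m * (2 * m - 1) = 2 * p - m := by rw [Nat.mul_sub_one, hp]; ring_nf
  rw [hdim, hM, hgoal]

/-- **The rank `t = e · m(2m − 1)` is skipped (type III(e)):** `dim MT(H¹B) ≠ e · m(2m − 1)` — `Lie Hg ⊆ Lef(ψ)` is never of
codimension one (no type IV) and `dim Lef(ψ) = e · m(2m − 1)`. [cite: Milne1999LefschetzClasses, §2 and Summary]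
[cite: MoonenZarhin1999LowDim, §1] -/
theorem mtRank_hodge_one_ne_lefschetz_of_isTotallyDefinite_centre {B : AbelianVariety ℂ} {k : ℕ} (hB : IsSmoothProjective k B.X)
    (hBs : B.IsSimple) {K : Type} [Field K] [NumberField K] [IsTotallyReal K] [Algebra K B.endAlgebra]
    [IsScalarTower ℚ K B.endAlgebra] [IsQuaternionAlgebra K B.endAlgebra] (hdef : IsTotallyDefinite K B.endAlgebra) {m : ℕ}
    (hm : 0 < m) (hBm : B.dim = 2 * m * Module.finrank ℚ K) :
    haveI := BettiUniverse.finite hB 1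
    (BettiUniverse.hodge exists_isReal_hodgeModel_holds hB 1).mtRank ≠ Module.finrank ℚ K * (m * (2 * m - 1)) := by
  haveI := BettiUniverse.finite hB 1
  obtain ⟨ψ⟩ := BettiUniverse.hodge_isPolarizable exists_isReal_hodgeModel_holds hB 1
  have h0 : 0 < B.dim := by rw [hBm]; exact Nat.mul_pos (Nat.mul_pos two_pos hm) Module.finrank_pos
  have hA4 : HasNoTypeIVFactor B := AbelianVariety.hasNoTypeIVFactor_of_isTotallyReal (K := K)
  have hne := finrank_lefschetz_ne_finrank_hodgeLie_add_one hB hA4 ψ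
  rw [finrank_lefschetz_eq_of_isTotallyDefinite_centre hB hBs hdef hBm ψ] at hne
  rw [mtRank_hodge_one_eq_finrank_hodgeLie_add_one hB h0]
  exact fun h => hne h.symm

/-- **Hodge = Lefschetz criterion (type III(e)):** `Lie Hg(H¹B) = C(End_Hdg(H¹B)) ∩ 𝔰𝔭(ψ)` iff `dim Lie Hg(H¹B) = e · m(2m − 1)`.
[cite: Milne1999LefschetzClasses, §2 and Summary] [cite: Murty1984ExceptionalHodgeClasses, §3] -/
theorem hodgeLie_hodge_one_eq_lefschetz_iff_of_isTotallyDefinite_centre {B : AbelianVariety ℂ} {k : ℕ}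
    (hB : IsSmoothProjective k B.X) (hBs : B.IsSimple) {K : Type} [Field K] [NumberField K] [IsTotallyReal K]
    [Algebra K B.endAlgebra] [IsScalarTower ℚ K B.endAlgebra] [IsQuaternionAlgebra K B.endAlgebra]
    (hdef : IsTotallyDefinite K B.endAlgebra) {m : ℕ} (hBm : B.dim = 2 * m * Module.finrank ℚ K)
    [Module.Finite ℚ (bettiCohomology B.X 1)] (ψ : (BettiUniverse.hodge exists_isReal_hodgeModel_holds hB 1).Polarization) :
    (BettiUniverse.hodge exists_isReal_hodgeModel_holds hB 1).hodgeLie = Subalgebra.toSubmodule (Subalgebra.centralizer ℚ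
        ((BettiUniverse.hodge exists_isReal_hodgeModel_holds hB 1).endAlg : Set (Module.End ℚ (bettiCohomology B.X 1)))) ⊓
      ψ.form.skewAdjointSubmodule ↔
      Module.finrank ℚ (BettiUniverse.hodge exists_isReal_hodgeModel_holds hB 1).hodgeLie =
        Module.finrank ℚ K * (m * (2 * m - 1)) := by
  have hL := finrank_lefschetz_eq_of_isTotallyDefinite_centre hB hBs hdef hBm ψ
  refine ⟨fun h => by rw [h, hL], fun h => Submodule.eq_of_le_of_finrank_eq (hodgeLie_hodge_one_le_lefschetz hB ψ) ?_⟩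
  rw [h, hL]

/-! ## §2 Type II(e): `dim Lef(ψ) = e · m(2m + 1)` -/

/-- **The Lefschetz Lie algebra of type II(e):** for `B` simple with `End⁰B` a totally indefinite quaternion algebra over a totally
real `K` of degree `e` and `dim B = 2em`, **`dim (C(End_Hdg(H¹B)) ∩ 𝔰𝔭(ψ)) = e · m(2m + 1)`** for every polarization `ψ`
(`Res_{K/ℚ} 𝔰𝔭_{2m}`-form, Milne's `g²/2f + g/2`). [cite: Milne1999LefschetzClasses, §2 (type II) and Summary]
[cite: Lange2023AbelianVarietiesComplex, §2.6.2 Thm. 2.6.5 (b)] -/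
theorem finrank_lefschetz_eq_of_isTotallyIndefinite_centre {B : AbelianVariety ℂ} {k : ℕ} (hB : IsSmoothProjective k B.X)
    (hBs : B.IsSimple) {K : Type} [Field K] [NumberField K] [IsTotallyReal K] [Algebra K B.endAlgebra]
    [IsScalarTower ℚ K B.endAlgebra] [IsQuaternionAlgebra K B.endAlgebra]
    (hind : Literature.RingTheory.CentralSimple.IsTotallyIndefinite K B.endAlgebra) {m : ℕ}
    (hBm : B.dim = 2 * m * Module.finrank ℚ K) [Module.Finite ℚ (bettiCohomology B.X 1)]
    (ψ : (BettiUniverse.hodge exists_isReal_hodgeModel_holds hB 1).Polarization) :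
    Module.finrank ℚ ↥(Subalgebra.toSubmodule (Subalgebra.centralizer ℚ
        ((BettiUniverse.hodge exists_isReal_hodgeModel_holds hB 1).endAlg : Set (Module.End ℚ (bettiCohomology B.X 1)))) ⊓
      ψ.form.skewAdjointSubmodule) = Module.finrank ℚ K * (m * (2 * m + 1)) := by
  classical
  have hk : B.dim = k := schemeDim_eq_holds hB
  subst hk
  -- the Rosati involution is `x ↦ w₀⁻¹ x̄ w₀`, `w₀² = α` totally negative
  have hD : ∀ x : B.endAlgebra, x ≠ 0 → IsUnit x := fun x hx => (isUnit_or_eq_zero_of_isSimple hBs x).resolve_right hx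
  have hA4 : HasNoTypeIVFactor B := AbelianVariety.hasNoTypeIVFactor_of_isTotallyReal (K := K)
  have hpos := AbelianVariety.isPositiveAntiInvolution_rosati (A := B) exists_isReal_hodgeModel_holds hodgePQ_independent_of_hodgeModel_holds ψ
  have h1 := AbelianVariety.isOfFirstKind_rosati (A := B) exists_isReal_hodgeModel_holds hodgePQ_independent_of_hodgeModel_holds ψ hA4 (K := K)
  obtain ⟨-, h⟩ := (isPositiveAntiInvolution_iff_of_isOfFirstKind K hD h1).mp hpos
  obtain ⟨w₀, α, hww, hαneg, hros⟩ : ∃ (w₀ : (B.endAlgebra)ˣ) (α : K), (w₀ : B.endAlgebra) * w₀ = algebraMap K _ α ∧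
      (∀ σ : K →+* ℝ, σ α < 0) ∧
      ∀ x, AbelianVariety.rosati B exists_isReal_hodgeModel_holds hodgePQ_independent_of_hodgeModel_holds ψ x = ↑w₀⁻¹ * standardInvolution K B.endAlgebra x * w₀ := by
    rcases h with ⟨hdef, -⟩ | ⟨-, w₀, α, hww, hαneg, hros⟩
    · obtain ⟨w⟩ : Nonempty (InfinitePlace K) := inferInstance
      exact absurd (hind.isSplitAtInfinite w) (hdef w)
    · exact ⟨w₀, α, hww, hαneg, hros⟩
  -- `w₀ ∉ K`: `α` is totally negative, not a square
  haveI : Nontrivial B.endAlgebra :=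
    Module.nontrivial_of_finrank_pos (R := K) (by rw [IsQuaternionAlgebra.finrank_eq_four (K := K) (D := B.endAlgebra)]; norm_num)
  have hwbot : (w₀ : B.endAlgebra) ∉ (⊥ : Subalgebra K B.endAlgebra) := by
    rw [Algebra.mem_bot]
    rintro ⟨c, hc⟩
    have h2 : algebraMap K B.endAlgebra (c * c) = algebraMap K B.endAlgebra α := by rw [map_mul, hc, hww]
    have hcc : c * c = α := (algebraMap K B.endAlgebra).injective h2
    obtain ⟨w⟩ : Nonempty (InfinitePlace K) := inferInstance
    have hw : w.IsReal := IsTotallyReal.isReal w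
    have hσ := hαneg (InfinitePlace.embedding_of_isReal hw)
    rw [← hcc, map_mul] at hσ
    nlinarith [mul_self_nonneg (InfinitePlace.embedding_of_isReal hw c)]
  obtain ⟨β, hα0, hβ0, e, hew⟩ := exists_algEquiv_quaternionAlgebra_apply_eq K hD hwbot hww
  set q := (QuaternionAlgebra.Basis.self K).compHom (e.symm : ℍ[K,α,β] →ₐ[K] B.endAlgebra) with hq
  have hqi : q.i = w₀ := by change e.symm ⟨0, 1, 0, 0⟩ = w₀; rw [← hew, AlgEquiv.symm_apply_apply]
  have hqj : q.j = e.symm ⟨0, 0, 1, 0⟩ := rfl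
  have hstar_i : standardInvolution K B.endAlgebra q.i = -q.i := by
    rw [hqi, ← e.symm_apply_apply (w₀ : B.endAlgebra), hew, standardInvolution_algEquiv, standardInvolution_quaternionAlgebra,
      ← map_neg]; congr 1; ext <;> simp
  have hstar_j : standardInvolution K B.endAlgebra q.j = -q.j := by
    rw [hqj, standardInvolution_algEquiv, standardInvolution_quaternionAlgebra, ← map_neg]; congr 1; ext <;> simp
  have hji' : q.j * q.i = -(q.i * q.j) := by rw [q.j_mul_i, q.i_mul_j, zero_smul, zero_sub]
  have hru : AbelianVariety.rosati B exists_isReal_hodgeModel_holds hodgePQ_independent_of_hodgeModel_holds ψ q.i = -q.i := by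
    rw [hros, hstar_i, hqi, mul_neg, neg_mul, Units.inv_mul, one_mul]
  have hrv : AbelianVariety.rosati B exists_isReal_hodgeModel_holds hodgePQ_independent_of_hodgeModel_holds ψ q.j = q.j := by
    rw [hros, hstar_j, mul_neg, neg_mul, mul_assoc, ← hqi, hji', mul_neg, ← mul_assoc, hqi, Units.inv_mul, one_mul, neg_neg]
  have hqb : Function.Bijective q.liftHom := by
    have hql : q.liftHom = (e.symm : ℍ[K,α,β] →ₐ[K] B.endAlgebra) := QuaternionAlgebra.lift.apply_symm_apply _
    rw [hql]; exact e.symm.bijective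
  obtain ⟨n, M, hn, hdim, -, h2⟩ := exists_finrank_lefschetz_eq_of_centre_basis (B := B) ψ hα0 hβ0 q hqb hru
  have hcount := h2 hrv
  have hdimV : Module.finrank ℚ (bettiCohomology B.X 1) = 4 * m * Module.finrank ℚ K := by
    rw [finrank_bettiCohomology_one_eq_two_mul_dim B, hBm]; ring
  have he : 0 < Module.finrank ℚ K := Module.finrank_pos
  have hn4 : n = 4 * m := by
    have h' : Module.finrank ℚ K * n = Module.finrank ℚ K * (4 * m) := by rw [hn, hdimV]; ring
    exact Nat.eq_of_mul_eq_mul_left he h'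
  subst hn4
  set p := m * m with hp
  have h16 : 4 * m * (4 * m) = 16 * p := by rw [hp]; ring
  rw [h16] at hcount
  have hM : M = 2 * p + m := by omega
  have hgoal : m * (2 * m + 1) = 2 * p + m := by rw [hp]; ring
  rw [hdim, hM, hgoal]

/-- **The rank `t = e · m(2m + 1)` is skipped (type II(e)):** `dim MT(H¹B) ≠ e · m(2m + 1)`.
[cite: Milne1999LefschetzClasses, §2 and Summary] [cite: MoonenZarhin1999LowDim, §1] -/
theorem mtRank_hodge_one_ne_lefschetz_of_isTotallyIndefinite_centre {B : AbelianVariety ℂ} {k : ℕ}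
    (hB : IsSmoothProjective k B.X) (hBs : B.IsSimple) {K : Type} [Field K] [NumberField K] [IsTotallyReal K]
    [Algebra K B.endAlgebra] [IsScalarTower ℚ K B.endAlgebra] [IsQuaternionAlgebra K B.endAlgebra]
    (hind : Literature.RingTheory.CentralSimple.IsTotallyIndefinite K B.endAlgebra) {m : ℕ} (hm : 0 < m)
    (hBm : B.dim = 2 * m * Module.finrank ℚ K) :
    haveI := BettiUniverse.finite hB 1
    (BettiUniverse.hodge exists_isReal_hodgeModel_holds hB 1).mtRank ≠ Module.finrank ℚ K * (m * (2 * m + 1)) := by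
  haveI := BettiUniverse.finite hB 1
  obtain ⟨ψ⟩ := BettiUniverse.hodge_isPolarizable exists_isReal_hodgeModel_holds hB 1
  have h0 : 0 < B.dim := by rw [hBm]; exact Nat.mul_pos (Nat.mul_pos two_pos hm) Module.finrank_pos
  have hA4 : HasNoTypeIVFactor B := AbelianVariety.hasNoTypeIVFactor_of_isTotallyReal (K := K)
  have hne := finrank_lefschetz_ne_finrank_hodgeLie_add_one hB hA4 ψ
  rw [finrank_lefschetz_eq_of_isTotallyIndefinite_centre hB hBs hind hBm ψ] at hne
  rw [mtRank_hodge_one_eq_finrank_hodgeLie_add_one hB h0]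
  exact fun h => hne h.symm

/-- **Hodge = Lefschetz criterion (type II(e)):** `Lie Hg(H¹B) = C(End_Hdg(H¹B)) ∩ 𝔰𝔭(ψ)` iff `dim Lie Hg(H¹B) = e · m(2m + 1)`.
[cite: Milne1999LefschetzClasses, §2 and Summary] [cite: Murty1984ExceptionalHodgeClasses, §3] -/
theorem hodgeLie_hodge_one_eq_lefschetz_iff_of_isTotallyIndefinite_centre {B : AbelianVariety ℂ} {k : ℕ}
    (hB : IsSmoothProjective k B.X) (hBs : B.IsSimple) {K : Type} [Field K] [NumberField K] [IsTotallyReal K]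
    [Algebra K B.endAlgebra] [IsScalarTower ℚ K B.endAlgebra] [IsQuaternionAlgebra K B.endAlgebra]
    (hind : Literature.RingTheory.CentralSimple.IsTotallyIndefinite K B.endAlgebra) {m : ℕ}
    (hBm : B.dim = 2 * m * Module.finrank ℚ K) [Module.Finite ℚ (bettiCohomology B.X 1)]
    (ψ : (BettiUniverse.hodge exists_isReal_hodgeModel_holds hB 1).Polarization) :
    (BettiUniverse.hodge exists_isReal_hodgeModel_holds hB 1).hodgeLie = Subalgebra.toSubmodule (Subalgebra.centralizer ℚ
        ((BettiUniverse.hodge exists_isReal_hodgeModel_holds hB 1).endAlg : Set (Module.End ℚ (bettiCohomology B.X 1)))) ⊓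
      ψ.form.skewAdjointSubmodule ↔
      Module.finrank ℚ (BettiUniverse.hodge exists_isReal_hodgeModel_holds hB 1).hodgeLie =
        Module.finrank ℚ K * (m * (2 * m + 1)) := by
  have hL := finrank_lefschetz_eq_of_isTotallyIndefinite_centre hB hBs hind hBm ψ
  refine ⟨fun h => by rw [h, hL], fun h => Submodule.eq_of_le_of_finrank_eq (hodgeLie_hodge_one_le_lefschetz hB ψ) ?_⟩
  rw [h, hL]

/-! ## §3 The `(2,2,2)` fourfolds: quaternion multiplication over a real quadratic field -/

/-- **`t = 7` for a simple abelian fourfold with quaternion multiplication over a real quadratic field** (`End⁰B` a quaternion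
algebra over a totally real `K` with `[K:ℚ] = 2`): type III(2) with `m = 1` is impossible (Shimura), so `End⁰B` is totally
indefinite and `t ≤ 2·3 + 1 = 7` (Lefschetz bound), `t ≠ 6` (skipped rank), `t ≠ 5` (no type IV), `t ≥ 4` (not CM) and `t ≠ 4`
(`dim_ℚ End⁰B = 8 ≠ 16`). [cite: MoonenZarhin1999LowDim, §1, §2 (2.3)] [cite: Milne1999LefschetzClasses, §2 and Summary]
[cite: Lange2023AbelianVarietiesComplex, §2.6.2 Thm. 2.6.5] -/
theorem mtRank_hodge_one_eq_seven_of_isSimple_fourfold_of_finrank_centre_eq_two {B : AbelianVariety ℂ} {k : ℕ}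
    (hB : IsSmoothProjective k B.X) (hBs : B.IsSimple) (hB4 : B.dim = 4) {K : Type} [Field K] [NumberField K] [IsTotallyReal K]
    [Algebra K B.endAlgebra] [IsScalarTower ℚ K B.endAlgebra] [IsQuaternionAlgebra K B.endAlgebra] (hK : Module.finrank ℚ K = 2) :
    haveI := BettiUniverse.finite hB 1
    (BettiUniverse.hodge exists_isReal_hodgeModel_holds hB 1).mtRank = 7 := by
  have hk : B.dim = k := schemeDim_eq_holds hB
  subst hk
  haveI := BettiUniverse.finite hB 1
  have hB0 : 0 < B.dim := by omega
  have hA4 : HasNoTypeIVFactor B := AbelianVariety.hasNoTypeIVFactor_of_isTotallyReal (K := K)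
  have hcm : ¬ IsOfCMType B := not_isOfCMType_of_hasNoTypeIVFactor hB hB0 hA4
  haveI : Module.Free K B.endAlgebra := @Module.Free.of_divisionRing K B.endAlgebra _ Ring.toAddCommGroup Algebra.toModule
  have hE8 : Module.finrank ℚ B.endAlgebra = 8 := by
    have h := Module.finrank_mul_finrank ℚ K B.endAlgebra
    rw [hK, IsQuaternionAlgebra.finrank_eq_four (K := K) (D := B.endAlgebra)] at h
    omega
  have hBm : B.dim = 2 * 1 * Module.finrank ℚ K := by rw [hB4, hK]
  have hind : Literature.RingTheory.CentralSimple.IsTotallyIndefinite K B.endAlgebra :=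
    AbelianVariety.isTotallyIndefinite_of_isSimple_of_dim_eq (K := K) hBs (by rw [hB4, hK])
  have h7 := mtRank_hodge_one_le_of_isTotallyIndefinite_centre hB hBs hind one_pos hBm
  have h6 := mtRank_hodge_one_ne_lefschetz_of_isTotallyIndefinite_centre hB hBs hind one_pos hBm
  rw [hK] at h7 h6
  obtain ⟨-, -, h5, -, -⟩ := mtRank_hodge_one_ne_of_hasNoTypeIVFactor hB hB0 hA4
  have h4 := four_le_mtRank_hodge_one_of_not_isOfCMType hB hcm
  have hne4 : (BettiUniverse.hodge exists_isReal_hodgeModel_holds hB 1).mtRank ≠ 4 := by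
    intro h
    obtain ⟨hsq, -, -⟩ := finrank_endAlgebra_eq_dim_sq_of_not_isOfCMType hB hB0 hcm h.le
    rw [hE8, hB4] at hsq
    norm_num at hsq
  omega

/-- **Hodge = Lefschetz for the `(2,2,2)` fourfolds:** for a simple abelian fourfold `B` with quaternion multiplication over a real
quadratic field, `Lie Hg(H¹B) = C(End_Hdg(H¹B)) ∩ 𝔰𝔭(ψ)` for every polarization `ψ` (both of dimension `6 = 2·1·3`) —
Moonen–Zarhin's Thm. (0.1) for `D_B` of type II(2) at the level of Lie algebras. [cite: MoonenZarhin1999LowDim, Thm. (0.1), §1, §2]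
[cite: Milne1999LefschetzClasses, §2 and Summary] -/
theorem hodgeLie_hodge_one_eq_lefschetz_of_isSimple_fourfold_of_finrank_centre_eq_two {B : AbelianVariety ℂ} {k : ℕ}
    (hB : IsSmoothProjective k B.X) (hBs : B.IsSimple) (hB4 : B.dim = 4) {K : Type} [Field K] [NumberField K] [IsTotallyReal K]
    [Algebra K B.endAlgebra] [IsScalarTower ℚ K B.endAlgebra] [IsQuaternionAlgebra K B.endAlgebra] (hK : Module.finrank ℚ K = 2)
    [Module.Finite ℚ (bettiCohomology B.X 1)] (ψ : (BettiUniverse.hodge exists_isReal_hodgeModel_holds hB 1).Polarization) :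
    (BettiUniverse.hodge exists_isReal_hodgeModel_holds hB 1).hodgeLie =
      Subalgebra.toSubmodule (Subalgebra.centralizer ℚ
        ((BettiUniverse.hodge exists_isReal_hodgeModel_holds hB 1).endAlg : Set (Module.End ℚ (bettiCohomology B.X 1)))) ⊓
      ψ.form.skewAdjointSubmodule := by
  have hk : B.dim = k := schemeDim_eq_holds hB
  subst hk
  have hB0 : 0 < B.dim := by omega
  have hBm : B.dim = 2 * 1 * Module.finrank ℚ K := by rw [hB4, hK]
  have hind : Literature.RingTheory.CentralSimple.IsTotallyIndefinite K B.endAlgebra :=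
    AbelianVariety.isTotallyIndefinite_of_isSimple_of_dim_eq (K := K) hBs (by rw [hB4, hK])
  have h7 := mtRank_hodge_one_eq_seven_of_isSimple_fourfold_of_finrank_centre_eq_two hB hBs hB4 (K := K) hK
  have ht := mtRank_hodge_one_eq_finrank_hodgeLie_add_one hB hB0
  refine (hodgeLie_hodge_one_eq_lefschetz_iff_of_isTotallyIndefinite_centre hB hBs hind hBm ψ).2 ?_
  rw [hK]
  omega

end Summit.HodgeConjecture.CorCM

end
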